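import Summits.Ventures.HodgeRepro.Groups
import Summits.Ventures.HodgeRepro.Faces
import Summits.Ventures.HodgeRepro.RouteCReflexModel
import Summits.Ventures.HodgeRepro.RouteCCosetModel

/-!
# The sixfold `A × E × E′` — the first face of the sealed row `Octic.Triquadratic` (`G = (ℤ/2)³`), the
route's «cheapest falsifier» of closer C5′ (`ROUTE.md` §4 item 1: «the first genuine test is a degree-8
face with `p = 6`: check that the sixfold `A × E × E′` is an Albanese factor of a compact `U(6,1)` Shimura
variety for a Galois CM field `E ⊇ F` of degree 8 — Liu Cor 4.20 with `Φ_μ` running over the three types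
lifted to `E` — a half-page check on reflex fields (R0, Shimura §8.3)»)

Blind re-derivation cell `pub-hodge-repro`, seat `night-1`.  The sealed representative is `(85, 3, 12)`
in the Cayley table of `Octic.Triquadratic` (`enum i = (i mod 2, ⌊i/2⌋ mod 2, ⌊i/4⌋ mod 2)`, `conj = 1 ↦
(1,0,0)`): the mask `85 = {0, 2, 4, 6}` is `Φ_E = {x : x₁ = 0}`, the masks `3 = {0, 1}` and `12 = {2, 3}`
are the places of `(0,0,0)` and of `(0,1,0)`.  In typer's model (`Groups.lean`: `C2xC2xC2 =
Multiplicative (ZMod 2 × ZMod 2 × ZMod 2)`, `cc_C2xC2xC2 = ofAdd (1,0,0)`) the face is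
`faceCorners cc Φ_E 1 (e 0 1 0)` with corners

* `T 0 = Φ_E = {(0,0,0), (0,1,0), (0,0,1), (0,1,1)}` — LIFTED from the imaginary quadratic subfield
  `k = F^{H}`, `H = {x₁ = 0}` (right stabiliser of order `4`): `A_{Φ_E} ∼ E⁴`, `E` an elliptic curve
  with CM by `k`;
* `T 1 = (Φ̄_E)^{(π)} = {(0,0,0), (1,1,0), (1,0,1), (1,1,1)} =: Φ_A` — PRIMITIVE: `A = A_{Φ_A}` a simple
  CM fourfold with CM by the whole field;
* `T 2 = (Φ̄_E)^{(π′)} = {(0,1,0), (1,0,0), (1,0,1), (1,1,1)} = Φ_A · (0,1,0)` — a Galois twist of `Φ_A`;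
* `T 3 = Φ_E^{(ππ′)} = {(0,0,1), (0,1,1), (1,0,0), (1,1,0)} =: Φ_{E′}` — LIFTED from the imaginary
  quadratic subfield `k′ = F^{H′}`, `H′ = {(0,0,0), (0,1,0), (1,0,1), (1,1,1)}`: `A_{Φ_{E′}} ∼ E′⁴`.

So `B ≅ E⁴ × A² × E′⁴` (sixteenfold) and `B_red = E × A × E′` is the SIXFOLD of ROUTE.md §3.3 («C2³: 6
classes, all 1+1+4 (A × E × E′, E, E′ CM by two DIFFERENT imaginary quadratic subfields)»), `g = 6`,
`k = 2`, `p = max(3k, g) = 6`, Liu's `n = 7`, BMM's range at `(6, 2)`: `3k = 6 = p`, the boundary of the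
closed set `[0, p/3]`.

What this file proves on the model (every statement a `decide` or an instance of a landed theorem):
the face data (`face_eq_corner`, `isCMType_reps`, the three right stabilisers, `cls_tw_injective`,
`sumTwo_face`, no conjugate corners, distinct corners); Lemma R's core on the CM-algebra side
(`isHodgeSetOn_cosetMap_reducedSet_face`: the reduced sets embed in the coset `G`-set
`G/H ⊔ G ⊔ G/H′` of `B_red = E × A × E′` as Pohlmann sets); the Liu types (`liuType Φ = Φ` here —
every element of `(ℤ/2)³` is its own inverse — so `Φ_{μ_E} = Φ_E`, `Φ_{μ_A} = Φ_A`, `Φ_{μ_{E′}} = Φ_{E′}`)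
and their reflex fields `E^{Stab Φ_μ} = E^{rstab Φ}` = `k`, `F`, `k′` (`reflexStab_liuType_reps`) — THE
HALF-PAGE CHECK ON REFLEX FIELDS of the route's cheapest falsifier, as kernel facts; and the numbers
(`sum_dim_simple : g = 6`, `bmm_range_face`).  The discharge from the printed clauses is
`RouteCFaceC2C2C2Discharge.lean`.  Nothing here says anything about the status of the Hodge conjecture for
CM abelian varieties, which is NOT proved.
-/

open Finset
open scoped Pointwise

namespace HodgeRepro.RouteC

namespace FaceC2C2C2

/-- `e a b c = ofAdd (a, b, c) ∈ (ℤ/2)³`. -/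
abbrev e (a b c : ZMod 2) : C2xC2xC2 := Multiplicative.ofAdd (a, b, c)

/-- Complex conjugation `(1,0,0)` (typer's `cc_C2xC2xC2`). -/
abbrev cc : C2xC2xC2 := cc_C2xC2xC2

/-- `Φ_E = {x : x₁ = 0}` (sealed mask `85`): the lift of the CM type of the imaginary quadratic subfield
`k = F^{x₁ = 0}`. -/
def Φ_E : Finset C2xC2xC2 := {e 0 0 0, e 0 1 0, e 0 0 1, e 0 1 1}

/-- `Φ_A = {(0,0,0), (1,1,0), (1,0,1), (1,1,1)}`: the corner `(Φ̄_E)^{(π)}`, primitive. -/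
def Φ_A : Finset C2xC2xC2 := {e 0 0 0, e 1 1 0, e 1 0 1, e 1 1 1}

/-- `Φ_{E′} = {(0,0,1), (0,1,1), (1,0,0), (1,1,0)}`: the corner `Φ_E^{(ππ′)}`, the lift of the CM type of
the imaginary quadratic subfield `k′ = F^{H′}`. -/
def Φ_E' : Finset C2xC2xC2 := {e 0 0 1, e 0 1 1, e 1 0 0, e 1 1 0}

/-- The place `π` of `(0,0,0)` (sealed mask `3`). -/
def π : C2xC2xC2 := e 0 0 0

/-- The place `π′` of `(0,1,0)` (sealed mask `12`). -/
def π' : C2xC2xC2 := e 0 1 0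

/-- The face `(Φ_E; π, π′)` of the sealed representative `(85, 3, 12)`. -/
def face : Fin 4 → Finset C2xC2xC2 := faceCorners cc Φ_E π π'

/-- The three isogeny-class representatives `Φ_E`, `Φ_A`, `Φ_{E′}`. -/
def reps : Fin 3 → Finset C2xC2xC2 := ![Φ_E, Φ_A, Φ_E']

/-- The class of each corner: `E`, `A`, `A`, `E′`. -/
def cls : Fin 4 → Fin 3 := ![0, 1, 1, 2]

/-- The twists: `T 2 = Φ_A · (0,1,0)`, the others untwisted. -/
def tw : Fin 4 → C2xC2xC2 := ![1, 1, e 0 1 0, 1]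

/-- `Φ_E` is a CM type. -/
theorem isCMType_Φ_E : IsCMType cc Φ_E := by decide

/-- All three representatives are CM types. -/
theorem isCMType_reps : ∀ k, IsCMType cc (reps k) := by decide

/-- `π′ ∉ {π, c π}`. -/
theorem π'_not_mem_place : π' ∉ place cc π := by decide

/-- **The corners sorted into classes and twists**: `T i = reps (cls i) · tw i`. -/
theorem face_eq_corner : face = corner reps cls tw := by decide

/-- The corners, explicitly. -/
theorem face_corners : face = ![Φ_E, Φ_A, {e 0 1 0, e 1 0 0, e 1 0 1, e 1 1 1}, Φ_E'] := by decide

/-- `Φ_A` is primitive: `A` is a simple CM fourfold. -/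
theorem isPrimitive_Φ_A : IsPrimitive Φ_A := by decide

/-- `rstab Φ_A = ⊥`. -/
theorem rstab_Φ_A : rstab Φ_A = ⊥ := (isPrimitive_iff_rstab_eq_bot _).1 isPrimitive_Φ_A

/-- The right stabiliser of `Φ_E` has order `4` (`H = {x₁ = 0}`): `A_{Φ_E} ∼ E⁴`. -/
theorem card_rstab_Φ_E : Fintype.card (rstab Φ_E) = 4 := by decide

/-- The right stabiliser of `Φ_{E′}` has order `4` (`H′`): `A_{Φ_{E′}} ∼ E′⁴`. -/
theorem card_rstab_Φ_E' : Fintype.card (rstab Φ_E') = 4 := by decide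

/-- `H = {x₁ = 0}` is the right stabiliser of `Φ_E`. -/
theorem mem_rstab_Φ_E : ∀ h, h ∈ rstab Φ_E ↔ h ∈ ({e 0 0 0, e 0 1 0, e 0 0 1, e 0 1 1} : Finset _) := by
  decide

/-- `H′ = {(0,0,0), (0,1,0), (1,0,1), (1,1,1)}` is the right stabiliser of `Φ_{E′}`. -/
theorem mem_rstab_Φ_E' :
    ∀ h, h ∈ rstab Φ_E' ↔ h ∈ ({e 0 0 0, e 0 1 0, e 1 0 1, e 1 1 1} : Finset _) := by
  decide

/-- The two quadratic subfields are DIFFERENT: `H ≠ H′`. -/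
theorem rstab_Φ_E_ne : rstab Φ_E ≠ rstab Φ_E' := by
  intro h
  have := (mem_rstab_Φ_E (e 0 0 1)).2 (by decide)
  rw [h, mem_rstab_Φ_E'] at this
  exact absurd this (by decide)

/-- The pairs `(class, twist)` are pairwise distinct (Lemma R's injectivity hypothesis). -/
theorem cls_tw_injective : Function.Injective fun i => (cls i, tw i) := by decide

/-- `SumTwo` (instance of typer's `sumTwo_faceCorners`). -/
theorem sumTwo_face : SumTwo face :=
  sumTwo_faceCorners cc_C2xC2xC2_isComplexConj isCMType_Φ_E π'_not_mem_place

/-- No two corners are complex-conjugate types. -/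
theorem face_noConjugateCorners : ∀ i j, face j ≠ cc • face i := by decide

/-- The four corners are pairwise distinct. -/
theorem face_corners_distinct : Function.Injective face := by decide

/-! ### Lemma R on the CM-algebra side: the reduced sets on `G/H ⊔ G ⊔ G/H′` -/

/-- The coset map of `B_red = E × A × E′` is injective on every reduced set `U_s` (the two `A`-corners
have distinct twists, the `E`- and `E′`-corners lie in different summands). -/
theorem injOn_cosetMap_reducedSet (s : C2xC2xC2) :
    Set.InjOn (cosetMap reps) (reducedSet cls tw s) := by
  have h : ∀ s : C2xC2xC2, ∀ a ∈ reducedSet cls tw s, ∀ b ∈ reducedSet cls tw s,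
      (a.1 = b.1 ∧ rmul (reps a.1) (a.2⁻¹ * b.2) = reps a.1) → a = b := by decide
  exact injOn_cosetMap_of_forall reps _ (h s)

/-- **Lemma R on this face**: the image of every reduced set `U_s` in the coset `G`-set of
`B_red = E × A × E′` is a Pohlmann set of its type — the `s`-line of `W_F(B)` is a codimension-2 Hodge
line on the sixfold. -/
theorem isHodgeSetOn_cosetMap_reducedSet_face (s : C2xC2xC2) :
    IsHodgeSetOn cc (cosetType reps) ((reducedSet cls tw s).image (cosetMap reps)) :=
  isHodgeSetOn_cosetMap_reducedSet cc_C2xC2xC2_isComplexConj reps cls tw cls_tw_injective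
    (face_eq_corner ▸ sumTwo_face) s (injOn_cosetMap_reducedSet s)

/-- The images have `4` elements. -/
theorem card_image_cosetMap_reducedSet_face (s : C2xC2xC2) :
    ((reducedSet cls tw s).image (cosetMap reps)).card = 4 := by
  rw [card_image_cosetMap_reducedSet reps cls tw cls_tw_injective s (injOn_cosetMap_reducedSet s),
    Fintype.card_fin]

/-! ### The Liu types and their reflex fields (R3/R4) — the half-page check on reflex fields -/

/-- In `(ℤ/2)³` every element is its own inverse, so `liuType Φ = Φ`: `Φ_{μ} = Φ` for each class. -/
theorem liuType_reps : ∀ k, liuType (reps k) = reps k := by decide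

/-- The three Liu types are CM types (the inputs of DR Lemma 3.5). -/
theorem isCMType_liuType_reps : ∀ k, IsCMType cc (liuType (reps k)) := fun k =>
  isCMType_liuType cc_C2xC2xC2_isComplexConj (isCMType_reps k)

/-- **The reflex fields of the three Liu types** are the fields of the corners: `E^{Stab Φ_μ} = E^{rstab Φ}`
— `k` (order-4 stabiliser `H`) for `E`, the whole field `F` (trivial stabiliser) for `A`, `k′` (`H′`)
for `E′`: Liu's `A_μ` is isogenous to a power of `E`, `A`, `E′` respectively (Shimura §8.3). -/
theorem reflexStab_liuType_reps : ∀ k, Hecke.reflexStab (liuType (reps k)) = rstab (reps k) :=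
  fun k => reflexStab_liuType (reps k)

/-- The reflex field of `Φ_{μ_A}` is `F` itself. -/
theorem reflexStab_liuType_Φ_A : Hecke.reflexStab (liuType Φ_A) = ⊥ :=
  reflexStab_liuType_eq_bot_of_isPrimitive isPrimitive_Φ_A

/-- The reflex field of `Φ_{μ_E}` is the quadratic field `k = F^{H}`: `Stab = rstab Φ_E`, of order `4`. -/
theorem card_reflexStab_liuType_Φ_E : Nat.card (Hecke.reflexStab (liuType Φ_E)) = 4 := by
  rw [reflexStab_liuType, Nat.card_eq_fintype_card, card_rstab_Φ_E]

/-! ### The numbers of the closer on this face -/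

/-- `|G| = 8`, `[E⁺ : ℚ] = 4 ≥ 2`. -/
theorem card_G : Nat.card C2xC2xC2 = 8 := by
  rw [Nat.card_eq_fintype_card]; exact card_C2xC2xC2

/-- The dimensions of the simple factors: `E` 1, `A` 4, `E′` 1. -/
theorem dim_simple : ∀ k, Nat.card C2xC2xC2 / (2 * Nat.card (rstab (reps k))) = ![1, 4, 1] k := by
  intro k
  rw [card_G]
  fin_cases k
  · show 8 / (2 * Nat.card (rstab Φ_E)) = 1
    rw [Nat.card_eq_fintype_card, card_rstab_Φ_E]
  · show 8 / (2 * Nat.card (rstab Φ_A)) = 4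
    rw [rstab_Φ_A, Subgroup.card_bot]
  · show 8 / (2 * Nat.card (rstab Φ_E')) = 1
    rw [Nat.card_eq_fintype_card, card_rstab_Φ_E']

/-- `g = dim B_red = 1 + 4 + 1 = 6`. -/
theorem sum_dim_simple : (∑ k, Nat.card C2xC2xC2 / (2 * Nat.card (rstab (reps k)))) = 6 := by
  rw [Finset.sum_congr rfl fun k _ => dim_simple k]
  decide

/-- The codimension `k = 2`, `g = 6`, `p = max(3k, g) = 6`. -/
def p : ℕ := max (3 * 2) 6

/-- `p = 6`. -/
theorem p_eq : p = 6 := by decide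

/-- Liu's `n = p + 1 = 7 ≥ 3`. -/
theorem three_le_n : 3 ≤ p + 1 := by decide

/-- **BMM Cor 2's range** at `(p, k) = (6, 2)`: `3k = 6 = p`, the boundary of the closed set — `2 ≤ 6` and
`¬ (6 < 6 ∧ 6 < 12)`. -/
theorem bmm_range_face : 2 ≤ p ∧ ¬ (p < 3 * 2 ∧ 3 * 2 < 2 * p) := by decide

end FaceC2C2C2

end HodgeRepro.RouteC
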